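import Summits.QuantumFields.YangMills.Theorems.BalabanLadderIRDefectSquaring
import HarnessLib

/-!
# Abstract purity basin — the dressed vacuum is rigid (cscan ym-ir-cscan-basin64 g2, negative-side helper)

Counterexample scan of `stub_abstractBasin36 : AbstractBasin (1/2^3) (1/24)` (line `basin-transfer`,
`Cruxes/IR/Lines/basin_transfer.lean`; crux `BalabanLadder.IR`, stmt-QuantumFields-19354), generation 2,
memo `pub/ym-ir/ym-ir-cscan-basin64/MEMO-cscan-g2-addendum.md` §2 (g3).  OUTCOME OF THE SCAN: NO KILL.

This file lands the algebraic core of the memo's THEOREM G («the dressed vacuum is rigid»).  A *dressed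
vacuum* is a member of the abstract `[Sym]+[TP]+[Vol]` class of the form
`Z(b) = e^{−κ b₁b₂b₃b₄} · M(2^{b₁},2^{b₂},2^{b₃},2^{b₄})`, `M` a real `S₄`-symmetric polynomial; trace
positivity makes every slice `M_s(X') := [X₄^s] M` ℕ-valued on the grid `G³`, `G = {2^x : x ≥ 2}`.  On the
face `X₂ = X₃ = P := 2^{L₀}` the rows `η_r(X) := M_r(X,P,P) = Σ_a h_{a r} X^a` have a SYMMETRIC coefficient
matrix `h` (the transposition `(1 4)` of `[Sym]`), every row is `≥ 0` on the unbounded set `G`, and if the cube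
`L₀` is `1/8`-pure with top level `s* ≥ 1` then the line identity `M(X,P,P,P) = M(P,P,P,X)` forces
`η_r(4) = 0` for all `r ≥ s*` while `η_{s*}(P) = 1 ≠ 0`.  `symmRows_false` below says that this configuration is
impossible: for a symmetric real matrix whose row polynomials are all non-negative on an unbounded set, the rows
`r ≥ s` cannot all vanish at a positive point unless row `s` is identically zero.  (Proof: the row of top index
`D` collects the leading coefficients of all rows, so it has non-negative, not-all-zero coefficients and cannot
vanish at a positive point; and `D ≥ s`.)  Consequently a dressed vacuum that is `1/8`-pure at one cube has
`s* = 0` there and, by the memo's propagation lemma (g1), `M ≡ 1`: no dressed-vacuum counterexample to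
`stub_abstractBasin36` exists, in any degree (memo §2 g3; the same argument covers signed integer representations
`e^{−κV}·Σ_j γ_j Π_i k_{j,i}^{b_i}` on a common vacuum).

HONEST FRAMING.  Nothing here proves or refutes the Yang–Mills mass gap (Clay), a lattice gap, `BalabanLadder.IR`
or `stub_abstractBasin36`; IR stays 0∕1; this is an elementary fact about symmetric real matrices, filed
`--supports` the crux item as the kernel anchor of the memo's no-go theorem for the dressed-vacuum design.
-/

namespace Summit.QuantumFields.YangMills.Cruxes.IR.BasinRung.DressedVacuumFace

open Finset

/-- **Symmetric face rigidity** (memo THEOREM G, algebraic core).  Let `h` be a real matrix, symmetric, supported in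
indices `< n`, such that every row polynomial `x ↦ Σ_{a<n} h a r · x^a` is non-negative on a set `S ⊆ ℝ` that is unbounded above.
If for some `s` all rows `r ≥ s` vanish at a point `x₀ > 0`, then row `s` is identically zero: `h a s = 0` for all `a`.
Stated as the contradiction used in the scan: the hypotheses together with `h a s ≠ 0` are inconsistent. -/
theorem symmRows_false (n : ℕ) (h : ℕ → ℕ → ℝ) (hsymm : ∀ a r, h a r = h r a)
    (hsupp : ∀ a r, n ≤ a → h a r = 0) (S : Set ℝ) (hS : ∀ B : ℝ, ∃ x ∈ S, B ≤ x)
    (hpos : ∀ r, ∀ x ∈ S, 0 ≤ ∑ a ∈ range n, h a r * x ^ a) (x₀ : ℝ) (hx₀ : 0 < x₀) (s : ℕ)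
    (hzero : ∀ r, s ≤ r → ∑ a ∈ range n, h a r * x₀ ^ a = 0) (a₀ : ℕ) (hne : h a₀ s ≠ 0) : False := by
  classical
  -- indices carrying a non-zero entry
  set T : Finset ℕ := (range n).filter (fun a => ∃ r, h a r ≠ 0) with hT
  have memT : ∀ a, (∃ r, h a r ≠ 0) → a ∈ T := by
    intro a ha
    obtain ⟨r, hr⟩ := ha
    have han : a < n := by
      by_contra hna
      exact hr (hsupp a r (Nat.le_of_not_lt hna))
    rw [hT, mem_filter]
    exact ⟨mem_range.mpr han, ⟨r, hr⟩⟩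
  have hsT : s ∈ T := memT s ⟨a₀, by rwa [hsymm] at hne⟩
  have hTne : T.Nonempty := ⟨s, hsT⟩
  set D : ℕ := T.max' hTne with hD
  have hDmem : D ∈ T := max'_mem T hTne
  have hsD : s ≤ D := le_max' T s hsT
  -- above `D` everything vanishes
  have habove : ∀ b r, D < b → h b r = 0 := by
    intro b r hb
    by_contra hbr
    have : b ≤ D := le_max' T b (memT b ⟨r, hbr⟩)
    omega
  -- `D` carries a non-zero entry
  have hDnz : ∃ r, h D r ≠ 0 := by
    have := hDmem
    rw [hT, mem_filter] at this
    exact this.2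
  -- STEP 1: every entry of row `D` is non-negative (it is the top coefficient of the corresponding row)
  have hnonneg : ∀ a, 0 ≤ h D a := by
    intro a
    by_contra hneg'
    have hneg : h D a < 0 := lt_of_not_ge hneg'
    set c : ℝ := h D a with hc
    set A : ℝ := ∑ b ∈ range n, |h b a| with hA
    have hA0 : 0 ≤ A := sum_nonneg (fun b _ => abs_nonneg _)
    obtain ⟨x, hxS, hxB⟩ := hS (A / (-c) + 1)
    have hnc : 0 < -c := by linarith
    have hx1 : 1 ≤ x := by
      have : 0 ≤ A / (-c) := div_nonneg hA0 hnc.le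
      linarith
    have hx0 : 0 ≤ x := by linarith
    have hxA : A < x * (-c) := by
      have h1 : A / (-c) < x := by linarith
      have := (div_lt_iff₀ hnc).mp h1
      linarith
    -- x * row a x = Σ_b h b a x^(b+1)
    have hrow : x * (∑ b ∈ range n, h b a * x ^ b) = ∑ b ∈ range n, h b a * x ^ (b + 1) := by
      rw [mul_sum]
      refine sum_congr rfl (fun b _ => ?_)
      ring
    have hDn : D < n := by
      have := hDmem
      rw [hT, mem_filter, mem_range] at this
      exact this.1
    have hsplit : ∑ b ∈ range n, h b a * x ^ (b + 1)
        = h D a * x ^ (D + 1) + ∑ b ∈ (range n).erase D, h b a * x ^ (b + 1) := by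
      rw [add_sum_erase (range n) (fun b => h b a * x ^ (b + 1)) (mem_range.mpr hDn)]
    -- bound the remainder by A * x^D
    have hrem : ∑ b ∈ (range n).erase D, h b a * x ^ (b + 1) ≤ A * x ^ D := by
      have hterm : ∀ b ∈ (range n).erase D, h b a * x ^ (b + 1) ≤ |h b a| * x ^ D := by
        intro b hb
        have hbD : b ≠ D := (mem_erase.mp hb).1
        rcases lt_or_gt_of_ne hbD with hlt | hgt
        · have hpow : x ^ (b + 1) ≤ x ^ D := pow_le_pow_right₀ hx1 (by omega)
          calc h b a * x ^ (b + 1) ≤ |h b a| * x ^ (b + 1) :=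
                mul_le_mul_of_nonneg_right (le_abs_self _) (pow_nonneg hx0 _)
            _ ≤ |h b a| * x ^ D := mul_le_mul_of_nonneg_left hpow (abs_nonneg _)
        · rw [habove b a hgt]
          simp only [zero_mul, abs_zero]
          exact le_refl _
      calc ∑ b ∈ (range n).erase D, h b a * x ^ (b + 1)
          ≤ ∑ b ∈ (range n).erase D, |h b a| * x ^ D := sum_le_sum hterm
        _ ≤ ∑ b ∈ range n, |h b a| * x ^ D :=
            sum_le_sum_of_subset_of_nonneg (erase_subset D (range n))
              (fun b _ _ => mul_nonneg (abs_nonneg _) (pow_nonneg hx0 _))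
        _ = A * x ^ D := by rw [hA, sum_mul]
    have hxD : 0 < x ^ D := pow_pos (by linarith) D
    have hup : x * (∑ b ∈ range n, h b a * x ^ b) < 0 := by
      rw [hrow, hsplit]
      have : h D a * x ^ (D + 1) + A * x ^ D < 0 := by
        have hfac : h D a * x ^ (D + 1) + A * x ^ D = x ^ D * (A - x * (-c)) := by
          rw [hc]; ring
        rw [hfac]
        exact mul_neg_of_pos_of_neg hxD (by linarith)
      linarith
    have hdown : 0 ≤ x * (∑ b ∈ range n, h b a * x ^ b) := mul_nonneg hx0 (hpos a x hxS)
    linarith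
  -- STEP 2: row `D` is positive at `x₀`, contradicting `hzero`
  obtain ⟨r₀, hr₀⟩ := hDnz
  have hr₀n : r₀ < n := by
    by_contra hrn
    exact hr₀ (by rw [hsymm]; exact hsupp r₀ D (Nat.le_of_not_lt hrn))
  have hposD : 0 < ∑ a ∈ range n, h a D * x₀ ^ a := by
    have hterms : ∀ a ∈ range n, 0 ≤ h a D * x₀ ^ a := by
      intro a _
      rw [hsymm]
      exact mul_nonneg (hnonneg a) (pow_nonneg hx₀.le _)
    have hone : 0 < h r₀ D * x₀ ^ r₀ := by
      rw [hsymm]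
      exact mul_pos (lt_of_le_of_ne (hnonneg r₀) (Ne.symm hr₀)) (pow_pos hx₀ _)
    calc (0 : ℝ) < h r₀ D * x₀ ^ r₀ := hone
      _ ≤ ∑ a ∈ range n, h a D * x₀ ^ a :=
          single_le_sum hterms (mem_range.mpr hr₀n)
  have := hzero D hsD
  linarith

end Summit.QuantumFields.YangMills.Cruxes.IR.BasinRung.DressedVacuumFace
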